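import Summits.Langlands.Langlands.Theorems.SqrtFiveQuarticCoversTraceDetTables

/-!
# The determinant-`±1` parts of the two Cartan normalisers of `GL₂(𝔽₅)` and the index-2 position of
# `H8` / `H12` inside them (CENSUS §3.2, §3.6; route rationale (i)) — kernel-checked

Route `Langlands/SqrtFiveQuarticCovers` (cell `pub/lg-quartmod`, F-L1).  Notation (in words; the
file declares nothing): `H8 = ⟨diag(2,3), antidiag(1,1)⟩`, `H12 = ⟨a, f⟩` with `a = (3 1;3 3)`
(`𝔽₅[a] ≅ 𝔽₂₅`, `a` of order `6`), `f = diag(1,4)`; `2·I = diag(2,2)` (determinant `-1`, central);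
`N_s^± := ⟨2·I, diag(2,3), antidiag(1,1)⟩`, `N_ns^± := ⟨2·I, a, f⟩`.

1. `mem_closure_insert_of_central`, `relIndex_closure_insert_eq_two` — for a central `z` with
   `z² ∈ ⟨S⟩ ∌ z`: `⟨z, S⟩ = ⟨S⟩ ∪ z⁻¹⟨S⟩` and `[⟨z, S⟩ : ⟨S⟩] = 2` (abstract groups).
2. `mem_normaliserSplit_iff`: `N_s^± = {g diagonal or antidiagonal, det g = ±1}` = the
   determinant-`±1` part of the normaliser of the split Cartan (FLS Prop. 1.1(b)'s group of order
   16); `mem_normaliserNonsplit_iff`: `N_ns^± = {g : g a g⁻¹ ∈ {a, a⁻¹}, det g = ±1}` = the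
   determinant-`±1` part of the normaliser of the non-split Cartan `𝔽₅[a]ˣ` (order 24).
3. `relIndex_H8_normaliserSplit`, `relIndex_H12_normaliserNonsplit`: `[N_s^± : H8] = 2`,
   `[N_ns^± : H12] = 2` — the refined curves `X(…, v, …)` are DOUBLE covers of Box's coarse
   Cartan-normaliser curves (CENSUS §3.2; with `det` this exhibits `N^±/(C ∩ SL₂) ≅ (ℤ/2)²`, whose
   three index-2 overgroups of `C ∩ SL₂` — `C^±`, `v`, `N^± ∩ SL₂` — are read off
   `mem_normaliser…_iff`, `mem_H8_iff`, `mem_H12_iff`).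
4. `span_detOne_normaliserSplit_eq_top`, `span_detOne_normaliserNonsplit_eq_top`: the
   determinant-one part of EITHER normaliser group SPANS `M₂(𝔽₅)`, so `N_s^±`, `N_ns^±` violate
   hypothesis (d) of the census `GroupCensusFive` (= FLS Remark (iii)(d), "`ρ̄(G_{K(ζ₅)})` absolutely
   reducible", fails): an elliptic curve whose mod-5 image is a whole `N^±` is NOT in the bad locus —
   the printed lifting theorem (FLS Thm 3) applies.  Route rationale (i): the generic members of
   Box's families of "`ℚ(√5)`-curves of unknown modularity" (image `N_ns^±`) need no new lifting
   theorem; only the index-2 subgroups `H8`, `H12` survive, whence the refined double covers.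
   (That `H8`, `H12` DO satisfy (a)–(d), and are mutually non-conjugate, is the sibling file
   `SqrtFiveQuarticCoversCensusTightness`.)

Finite group theory / linear algebra over `ZMod 5` only; every residual check is a `decide` on
closed `2 × 2` matrices or over at most one element of `ZMod 5`; no definitions; standard axioms.
Nothing here is a statement about modular curves or elliptic curves.  References:
[FreitasLeHungSiksek2015] Remark (iii) after Cor. 2.1 and Prop. 1.1(b); [Box2022] §7.1; CENSUS.md
§3 of the cell.
-/

set_option linter.dupNamespace false -- project-wide option (lakefile weak.linter.dupNamespace); `Summit.Langlands.Langlands` is the mandated namespace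

namespace Summit.Langlands.Langlands.Theorems.GroupCensusFive

open Matrix

/-! ## 1. A central element of square in `⟨S⟩` -/

/-- For `z` central with `z * z ∈ ⟨S⟩`: `g ∈ ⟨z, S⟩ ↔ g ∈ ⟨S⟩ ∨ z * g ∈ ⟨S⟩`. [folklore] -/
theorem mem_closure_insert_of_central {Γ : Type*} [Group Γ] {S : Set Γ} {z : Γ}
    (hz : ∀ x : Γ, x * z = z * x) (hzz : z * z ∈ Subgroup.closure S) (g : Γ) :
    g ∈ Subgroup.closure (insert z S) ↔
      g ∈ Subgroup.closure S ∨ z * g ∈ Subgroup.closure S := by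
  constructor
  · intro hg
    let K : Subgroup Γ :=
      { carrier := {u | u ∈ Subgroup.closure S ∨ z * u ∈ Subgroup.closure S}
        mul_mem' := by
          rintro u v (hu | hu) (hv | hv)
          · exact Or.inl (Subgroup.mul_mem _ hu hv)
          · right
            have : z * (u * v) = u * (z * v) := by rw [← mul_assoc, ← hz u, mul_assoc]
            rw [this]; exact Subgroup.mul_mem _ hu hv
          · right
            rw [← mul_assoc]; exact Subgroup.mul_mem _ hu hv
          · left
            have : u * v = (z * z)⁻¹ * ((z * u) * (z * v)) := by
              rw [show (z * u) * (z * v) = (z * z) * (u * v) by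
                rw [mul_assoc, ← mul_assoc u z v, hz u, mul_assoc, mul_assoc]]
              rw [← mul_assoc, inv_mul_cancel, one_mul]
            rw [this]
            exact Subgroup.mul_mem _ (Subgroup.inv_mem _ hzz) (Subgroup.mul_mem _ hu hv)
        one_mem' := Or.inl (Subgroup.one_mem _)
        inv_mem' := by
          rintro u (hu | hu)
          · exact Or.inl (Subgroup.inv_mem _ hu)
          · right
            have : z * u⁻¹ = (z * z) * (z * u)⁻¹ := by
              rw [← hz u, _root_.mul_inv_rev, ← mul_assoc, mul_assoc z z z⁻¹, mul_inv_cancel, mul_one]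
            rw [this]
            exact Subgroup.mul_mem _ hzz (Subgroup.inv_mem _ hu) }
    have hle : Subgroup.closure (insert z S) ≤ K := by
      rw [Subgroup.closure_le]
      rintro x (rfl | hx)
      · exact Or.inr hzz
      · exact Or.inl (Subgroup.subset_closure hx)
    exact hle hg
  · rintro (hg | hg)
    · exact Subgroup.closure_mono (Set.subset_insert _ _) hg
    · have hz' : z ∈ Subgroup.closure (insert z S) := Subgroup.subset_closure (Set.mem_insert _ _)
      have : g = z⁻¹ * (z * g) := by rw [← mul_assoc, inv_mul_cancel, one_mul]
      rw [this]
      exact Subgroup.mul_mem _ (Subgroup.inv_mem _ hz')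
        (Subgroup.closure_mono (Set.subset_insert _ _) hg)

/-- For `z` central with `z * z ∈ ⟨S⟩` and `z ∉ ⟨S⟩`: `⟨S⟩` has index `2` in `⟨z, S⟩`. [folklore] -/
theorem relIndex_closure_insert_eq_two {Γ : Type*} [Group Γ] {S : Set Γ} {z : Γ}
    (hz : ∀ x : Γ, x * z = z * x) (hzz : z * z ∈ Subgroup.closure S)
    (hzS : z ∉ Subgroup.closure S) :
    (Subgroup.closure S).relIndex (Subgroup.closure (insert z S)) = 2 := by
  rw [Subgroup.relIndex_eq_two_iff]
  refine ⟨z, Subgroup.subset_closure (Set.mem_insert _ _), fun b hb => ?_⟩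
  rw [mem_closure_insert_of_central hz hzz] at hb
  rcases hb with hb | hb
  · refine Or.inr ⟨hb, fun h => hzS ?_⟩
    have : z = b⁻¹ * (b * z) := by rw [← mul_assoc, inv_mul_cancel, one_mul]
    rw [this]; exact Subgroup.mul_mem _ (Subgroup.inv_mem _ hb) h
  · refine Or.inl ⟨by rw [hz]; exact hb, fun h => hzS ?_⟩
    have : z = (z * b) * b⁻¹ := by rw [mul_assoc, mul_inv_cancel, mul_one]
    rw [this]; exact Subgroup.mul_mem _ hb (Subgroup.inv_mem _ h)

/-! ## 2. The scalar `2·I` -/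

/-- `2·I` is central in `GL₂(𝔽₅)`. [folklore] -/
theorem mul_two_eq_two_mul (x : GL (Fin 2) (ZMod 5)) :
    x * (⟨!![2, 0; 0, 2], !![3, 0; 0, 3], by decide, by decide⟩ : GL (Fin 2) (ZMod 5)) =
      (⟨!![2, 0; 0, 2], !![3, 0; 0, 3], by decide, by decide⟩ : GL (Fin 2) (ZMod 5)) * x := by
  refine Units.ext ?_
  obtain ⟨p, q, r, s, hx⟩ := exists_eq_fin_two (x : Matrix (Fin 2) (Fin 2) (ZMod 5))
  rw [Units.val_mul, Units.val_mul, hx]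
  change !![p, q; r, s] * (!![2, 0; 0, 2] : Matrix (Fin 2) (Fin 2) (ZMod 5)) = !![2, 0; 0, 2] * !![p, q; r, s]
  ext i j
  fin_cases i <;> fin_cases j <;> simp [Matrix.mul_apply, Fin.sum_univ_two, mul_comm]

/-- `(2·I) * g = 2 • g` as matrices. [folklore] -/
theorem val_two_mul (g : GL (Fin 2) (ZMod 5)) :
    (((⟨!![2, 0; 0, 2], !![3, 0; 0, 3], by decide, by decide⟩ : GL (Fin 2) (ZMod 5)) * g :
      GL (Fin 2) (ZMod 5)) : Matrix (Fin 2) (Fin 2) (ZMod 5)) = (2 : ZMod 5) • (g : Matrix (Fin 2) (Fin 2) (ZMod 5)) := by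
  obtain ⟨p, q, r, s, hg⟩ := exists_eq_fin_two (g : Matrix (Fin 2) (Fin 2) (ZMod 5))
  rw [Units.val_mul, hg]
  change (!![2, 0; 0, 2] : Matrix (Fin 2) (Fin 2) (ZMod 5)) * !![p, q; r, s] = (2 : ZMod 5) • !![p, q; r, s]
  ext i j
  fin_cases i <;> fin_cases j <;> simp [Matrix.mul_apply, Fin.sum_univ_two]

/-- Cancelling the scalar `2`: `2 • X = 2 • Y ↔ X = Y` in `M₂(𝔽₅)`. [folklore] -/
theorem two_smul_inj (X Y : Matrix (Fin 2) (Fin 2) (ZMod 5)) :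
    (2 : ZMod 5) • X = (2 : ZMod 5) • Y ↔ X = Y := by
  constructor
  · intro h
    have h3 := congrArg (fun Z : Matrix (Fin 2) (Fin 2) (ZMod 5) => (3 : ZMod 5) • Z) h
    simp only [smul_smul] at h3
    rwa [show (3 : ZMod 5) * 2 = 1 by decide, one_smul, one_smul] at h3
  · rintro rfl; rfl

/-- `det (2·I * g) = 4 * det g = - det g`. [folklore] -/
theorem det_two_mul (g : GL (Fin 2) (ZMod 5)) :
    Matrix.det (((⟨!![2, 0; 0, 2], !![3, 0; 0, 3], by decide, by decide⟩ : GL (Fin 2) (ZMod 5)) * g :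
      GL (Fin 2) (ZMod 5)) : Matrix (Fin 2) (Fin 2) (ZMod 5)) = 4 * Matrix.det (g : Matrix (Fin 2) (Fin 2) (ZMod 5)) := by
  rw [Units.val_mul, Matrix.det_mul]
  change Matrix.det (!![2, 0; 0, 2] : Matrix (Fin 2) (Fin 2) (ZMod 5)) * _ = _
  rw [Matrix.det_fin_two_of]
  norm_num

/-- `(2·I)² = -I ∈ H8`. [folklore] -/
theorem two_mul_two_mem_H8 :
    (⟨!![2, 0; 0, 2], !![3, 0; 0, 3], by decide, by decide⟩ : GL (Fin 2) (ZMod 5)) *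
        (⟨!![2, 0; 0, 2], !![3, 0; 0, 3], by decide, by decide⟩ : GL (Fin 2) (ZMod 5)) ∈
      Subgroup.closure ({(⟨!![2, 0; 0, 3], !![3, 0; 0, 2], by decide, by decide⟩ : GL (Fin 2) (ZMod 5)),
        (⟨!![0, 1; 1, 0], !![0, 1; 1, 0], by decide, by decide⟩ : GL (Fin 2) (ZMod 5))} :
          Set (GL (Fin 2) (ZMod 5))) := by
  have : (⟨!![2, 0; 0, 2], !![3, 0; 0, 3], by decide, by decide⟩ : GL (Fin 2) (ZMod 5)) *
      (⟨!![2, 0; 0, 2], !![3, 0; 0, 3], by decide, by decide⟩ : GL (Fin 2) (ZMod 5)) =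
      ⟨!![4, 0; 0, 4], !![4, 0; 0, 4], by decide, by decide⟩ := Units.ext (by decide)
  rw [this]; exact neg_one_mem_H8

/-- `(2·I)² = -I ∈ H12`. [folklore] -/
theorem two_mul_two_mem_H12 :
    (⟨!![2, 0; 0, 2], !![3, 0; 0, 3], by decide, by decide⟩ : GL (Fin 2) (ZMod 5)) *
        (⟨!![2, 0; 0, 2], !![3, 0; 0, 3], by decide, by decide⟩ : GL (Fin 2) (ZMod 5)) ∈
      Subgroup.closure ({(⟨!![3, 1; 3, 3], !![3, 4; 2, 3], by decide, by decide⟩ : GL (Fin 2) (ZMod 5)),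
        (⟨!![1, 0; 0, 4], !![1, 0; 0, 4], by decide, by decide⟩ : GL (Fin 2) (ZMod 5))} : Set (GL (Fin 2) (ZMod 5))) := by
  have : (⟨!![2, 0; 0, 2], !![3, 0; 0, 3], by decide, by decide⟩ : GL (Fin 2) (ZMod 5)) *
      (⟨!![2, 0; 0, 2], !![3, 0; 0, 3], by decide, by decide⟩ : GL (Fin 2) (ZMod 5)) =
      ⟨!![4, 0; 0, 4], !![4, 0; 0, 4], by decide, by decide⟩ := Units.ext (by decide)
  rw [this]; exact neg_one_mem_H12

/-- `2·I ∉ H8` (it is diagonal of determinant `-1`). [folklore] -/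
theorem two_not_mem_H8 :
    (⟨!![2, 0; 0, 2], !![3, 0; 0, 3], by decide, by decide⟩ : GL (Fin 2) (ZMod 5)) ∉
      Subgroup.closure ({(⟨!![2, 0; 0, 3], !![3, 0; 0, 2], by decide, by decide⟩ : GL (Fin 2) (ZMod 5)),
        (⟨!![0, 1; 1, 0], !![0, 1; 1, 0], by decide, by decide⟩ : GL (Fin 2) (ZMod 5))} :
          Set (GL (Fin 2) (ZMod 5))) := by
  intro h
  rcases (mem_H8_iff _).1 h with ⟨-, -, hd⟩ | ⟨h00, -, -⟩
  · revert hd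
    change Matrix.det (!![2, 0; 0, 2] : Matrix (Fin 2) (Fin 2) (ZMod 5)) = 1 → False
    rw [Matrix.det_fin_two_of]; decide
  · revert h00; decide

/-- `2·I ∉ H12` (it commutes with `a` and has determinant `-1`). [folklore] -/
theorem two_not_mem_H12 :
    (⟨!![2, 0; 0, 2], !![3, 0; 0, 3], by decide, by decide⟩ : GL (Fin 2) (ZMod 5)) ∉
      Subgroup.closure ({(⟨!![3, 1; 3, 3], !![3, 4; 2, 3], by decide, by decide⟩ : GL (Fin 2) (ZMod 5)),
        (⟨!![1, 0; 0, 4], !![1, 0; 0, 4], by decide, by decide⟩ : GL (Fin 2) (ZMod 5))} : Set (GL (Fin 2) (ZMod 5))) := by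
  intro h
  rcases (mem_H12_iff _).1 h with ⟨-, hd⟩ | ⟨hc, -⟩
  · revert hd
    change Matrix.det (!![2, 0; 0, 2] : Matrix (Fin 2) (Fin 2) (ZMod 5)) = 1 → False
    rw [Matrix.det_fin_two_of]; decide
  · revert hc
    change (!![2, 0; 0, 2] : Matrix (Fin 2) (Fin 2) (ZMod 5)) * !![3, 1; 3, 3] = !![3, 4; 2, 3] * !![2, 0; 0, 2] → False
    decide

/-! ## 3. The determinant-`±1` parts of the Cartan normalisers, as `⟨2·I, v⟩` -/

/-- **`N_s^± = ⟨2·I, diag(2,3), antidiag(1,1)⟩` is the set of diagonal-or-antidiagonal elements of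
determinant `±1`** — the determinant-`±1` part of the normaliser of the split Cartan subgroup of
`GL₂(𝔽₅)` (order 16; the group `H` of FLS Prop. 1.1(b)). [folklore] -/
theorem mem_normaliserSplit_iff (g : GL (Fin 2) (ZMod 5)) :
    g ∈ Subgroup.closure ({(⟨!![2, 0; 0, 2], !![3, 0; 0, 3], by decide, by decide⟩ : GL (Fin 2) (ZMod 5)),
      (⟨!![2, 0; 0, 3], !![3, 0; 0, 2], by decide, by decide⟩ : GL (Fin 2) (ZMod 5)),
      (⟨!![0, 1; 1, 0], !![0, 1; 1, 0], by decide, by decide⟩ : GL (Fin 2) (ZMod 5))} :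
        Set (GL (Fin 2) (ZMod 5))) ↔
    ((((g : Matrix (Fin 2) (Fin 2) (ZMod 5)) 0 1 = 0 ∧ (g : Matrix (Fin 2) (Fin 2) (ZMod 5)) 1 0 = 0) ∨
        ((g : Matrix (Fin 2) (Fin 2) (ZMod 5)) 0 0 = 0 ∧ (g : Matrix (Fin 2) (Fin 2) (ZMod 5)) 1 1 = 0)) ∧
      (Matrix.det (g : Matrix (Fin 2) (Fin 2) (ZMod 5)) = 1 ∨
        Matrix.det (g : Matrix (Fin 2) (Fin 2) (ZMod 5)) = -1)) := by
  rw [mem_closure_insert_of_central mul_two_eq_two_mul two_mul_two_mem_H8, mem_H8_iff, mem_H8_iff,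
    det_two_mul]
  have h4 : ∀ i j : Fin 2, (((⟨!![2, 0; 0, 2], !![3, 0; 0, 3], by decide, by decide⟩ : GL (Fin 2) (ZMod 5)) * g :
      GL (Fin 2) (ZMod 5)) : Matrix (Fin 2) (Fin 2) (ZMod 5)) i j = 2 * (g : Matrix (Fin 2) (Fin 2) (ZMod 5)) i j := by
    intro i j
    rw [val_two_mul, Matrix.smul_apply, smul_eq_mul]
  rw [h4, h4, h4, h4]
  have h2 : ∀ x : ZMod 5, 2 * x = 0 ↔ x = 0 := by decide
  generalize Matrix.det (g : Matrix (Fin 2) (Fin 2) (ZMod 5)) = d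
  have h41 : 4 * d = 1 ↔ d = -1 := by revert d; decide
  have h42 : 4 * d = -1 ↔ d = 1 := by revert d; decide
  rw [h2, h2, h2, h2, h41, h42]
  tauto

/-- **`N_ns^± = ⟨2·I, a, f⟩` is the set of `g` with `g a g⁻¹ ∈ {a, a⁻¹}` and determinant `±1`** —
the determinant-`±1` part of the normaliser of the non-split Cartan subgroup `𝔽₅[a]ˣ ≅ 𝔽₂₅ˣ` of
`GL₂(𝔽₅)` (order 24 `= C₁₂ ⋊ ⟨f⟩`). [folklore] -/
theorem mem_normaliserNonsplit_iff (g : GL (Fin 2) (ZMod 5)) :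
    g ∈ Subgroup.closure ({(⟨!![2, 0; 0, 2], !![3, 0; 0, 3], by decide, by decide⟩ : GL (Fin 2) (ZMod 5)),
      (⟨!![3, 1; 3, 3], !![3, 4; 2, 3], by decide, by decide⟩ : GL (Fin 2) (ZMod 5)),
      (⟨!![1, 0; 0, 4], !![1, 0; 0, 4], by decide, by decide⟩ : GL (Fin 2) (ZMod 5))} : Set (GL (Fin 2) (ZMod 5))) ↔
    (((g : Matrix (Fin 2) (Fin 2) (ZMod 5)) * !![3, 1; 3, 3] = !![3, 1; 3, 3] * (g : Matrix (Fin 2) (Fin 2) (ZMod 5)) ∨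
        (g : Matrix (Fin 2) (Fin 2) (ZMod 5)) * !![3, 1; 3, 3] = !![3, 4; 2, 3] * (g : Matrix (Fin 2) (Fin 2) (ZMod 5))) ∧
      (Matrix.det (g : Matrix (Fin 2) (Fin 2) (ZMod 5)) = 1 ∨
        Matrix.det (g : Matrix (Fin 2) (Fin 2) (ZMod 5)) = -1)) := by
  rw [mem_closure_insert_of_central mul_two_eq_two_mul two_mul_two_mem_H12, mem_H12_iff, mem_H12_iff,
    det_two_mul, val_two_mul, Matrix.smul_mul, Matrix.mul_smul, Matrix.mul_smul, two_smul_inj,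
    two_smul_inj]
  generalize Matrix.det (g : Matrix (Fin 2) (Fin 2) (ZMod 5)) = d
  have h1 : 4 * d = 1 ↔ d = -1 := by revert d; decide
  have h2 : 4 * d = -1 ↔ d = 1 := by revert d; decide
  rw [h1, h2]
  tauto

/-! ## 4. Index two -/

/-- **`[N_s^± : H8] = 2`**: `H8` is an index-2 subgroup of the determinant-`±1` part of the split
Cartan normaliser (CENSUS §3.2: the refined curve `X(…, H8, …)` is a double cover of Box's
`X(…, s5, …)` over `ℚ(√5)`). [folklore] -/
theorem relIndex_H8_normaliserSplit :
    (Subgroup.closure ({(⟨!![2, 0; 0, 3], !![3, 0; 0, 2], by decide, by decide⟩ : GL (Fin 2) (ZMod 5)),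
        (⟨!![0, 1; 1, 0], !![0, 1; 1, 0], by decide, by decide⟩ : GL (Fin 2) (ZMod 5))} :
          Set (GL (Fin 2) (ZMod 5)))).relIndex
      (Subgroup.closure ({(⟨!![2, 0; 0, 2], !![3, 0; 0, 3], by decide, by decide⟩ : GL (Fin 2) (ZMod 5)),
        (⟨!![2, 0; 0, 3], !![3, 0; 0, 2], by decide, by decide⟩ : GL (Fin 2) (ZMod 5)),
        (⟨!![0, 1; 1, 0], !![0, 1; 1, 0], by decide, by decide⟩ : GL (Fin 2) (ZMod 5))} :
          Set (GL (Fin 2) (ZMod 5)))) = 2 :=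
  relIndex_closure_insert_eq_two mul_two_eq_two_mul two_mul_two_mem_H8 two_not_mem_H8

/-- **`[N_ns^± : H12] = 2`**: `H12` is an index-2 subgroup of the determinant-`±1` part of the
non-split Cartan normaliser (CENSUS §3.2: `X(…, H12, …)` is a double cover of Box's `X(…, ns5, …)`
over `ℚ(√5)`). [folklore] -/
theorem relIndex_H12_normaliserNonsplit :
    (Subgroup.closure ({(⟨!![3, 1; 3, 3], !![3, 4; 2, 3], by decide, by decide⟩ : GL (Fin 2) (ZMod 5)),
        (⟨!![1, 0; 0, 4], !![1, 0; 0, 4], by decide, by decide⟩ : GL (Fin 2) (ZMod 5))} : Set (GL (Fin 2) (ZMod 5)))).relIndex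
      (Subgroup.closure ({(⟨!![2, 0; 0, 2], !![3, 0; 0, 3], by decide, by decide⟩ : GL (Fin 2) (ZMod 5)),
        (⟨!![3, 1; 3, 3], !![3, 4; 2, 3], by decide, by decide⟩ : GL (Fin 2) (ZMod 5)),
        (⟨!![1, 0; 0, 4], !![1, 0; 0, 4], by decide, by decide⟩ : GL (Fin 2) (ZMod 5))} : Set (GL (Fin 2) (ZMod 5)))) = 2 :=
  relIndex_closure_insert_eq_two mul_two_eq_two_mul two_mul_two_mem_H12 two_not_mem_H12

/-! ## 5. The determinant-one part of a normaliser spans `M₂(𝔽₅)` (hypothesis (d) fails) -/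

/-- Every `2 × 2` matrix is the combination of the four elementary matrices with its entries as
coefficients. [folklore] -/
theorem eq_smul_elementary (M : Matrix (Fin 2) (Fin 2) (ZMod 5)) :
    M = M 0 0 • (!![1, 0; 0, 0] : Matrix (Fin 2) (Fin 2) (ZMod 5)) + M 0 1 • !![0, 1; 0, 0] +
      M 1 0 • !![0, 0; 1, 0] + M 1 1 • !![0, 0; 0, 1] := by
  ext i j
  fin_cases i <;> fin_cases j <;> simp

/-- A submodule of `M₂(𝔽₅)` containing the four elementary matrices is everything. [folklore] -/
theorem eq_top_of_elementary_mem (W : Submodule (ZMod 5) (Matrix (Fin 2) (Fin 2) (ZMod 5)))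
    (h00 : (!![1, 0; 0, 0] : Matrix (Fin 2) (Fin 2) (ZMod 5)) ∈ W)
    (h01 : (!![0, 1; 0, 0] : Matrix (Fin 2) (Fin 2) (ZMod 5)) ∈ W)
    (h10 : (!![0, 0; 1, 0] : Matrix (Fin 2) (Fin 2) (ZMod 5)) ∈ W)
    (h11 : (!![0, 0; 0, 1] : Matrix (Fin 2) (Fin 2) (ZMod 5)) ∈ W) : W = ⊤ := by
  rw [eq_top_iff]
  intro M _
  rw [eq_smul_elementary M]
  exact W.add_mem (W.add_mem (W.add_mem (W.smul_mem _ h00) (W.smul_mem _ h01)) (W.smul_mem _ h10))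
    (W.smul_mem _ h11)

/-- **The determinant-one part of `N_s^±` spans `M₂(𝔽₅)`** (it contains `1`, `diag(2,3)`,
`antidiag(1,4)`, `antidiag(2,2)`): the split Cartan normaliser violates hypothesis (d) of the
census `GroupCensusFive`. [folklore] -/
theorem span_detOne_normaliserSplit_eq_top :
    Submodule.span (ZMod 5) ((fun g : GL (Fin 2) (ZMod 5) => ((g : GL (Fin 2) (ZMod 5)) : Matrix (Fin 2) (Fin 2) (ZMod 5))) ''
      {g : GL (Fin 2) (ZMod 5) | g ∈ Subgroup.closure ({(⟨!![2, 0; 0, 2], !![3, 0; 0, 3], by decide, by decide⟩ : GL (Fin 2) (ZMod 5)),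
        (⟨!![2, 0; 0, 3], !![3, 0; 0, 2], by decide, by decide⟩ : GL (Fin 2) (ZMod 5)),
        (⟨!![0, 1; 1, 0], !![0, 1; 1, 0], by decide, by decide⟩ : GL (Fin 2) (ZMod 5))} : Set (GL (Fin 2) (ZMod 5))) ∧
        Matrix.det ((g : GL (Fin 2) (ZMod 5)) : Matrix (Fin 2) (Fin 2) (ZMod 5)) = 1}) = ⊤ := by
  have mem : ∀ u : GL (Fin 2) (ZMod 5),
      (((u : Matrix (Fin 2) (Fin 2) (ZMod 5)) 0 1 = 0 ∧ (u : Matrix (Fin 2) (Fin 2) (ZMod 5)) 1 0 = 0) ∨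
        ((u : Matrix (Fin 2) (Fin 2) (ZMod 5)) 0 0 = 0 ∧ (u : Matrix (Fin 2) (Fin 2) (ZMod 5)) 1 1 = 0)) →
      Matrix.det (u : Matrix (Fin 2) (Fin 2) (ZMod 5)) = 1 →
      (u : Matrix (Fin 2) (Fin 2) (ZMod 5)) ∈ Submodule.span (ZMod 5) ((fun g : GL (Fin 2) (ZMod 5) => ((g : GL (Fin 2) (ZMod 5)) : Matrix (Fin 2) (Fin 2) (ZMod 5))) ''
      {g : GL (Fin 2) (ZMod 5) | g ∈ Subgroup.closure ({(⟨!![2, 0; 0, 2], !![3, 0; 0, 3], by decide, by decide⟩ : GL (Fin 2) (ZMod 5)),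
        (⟨!![2, 0; 0, 3], !![3, 0; 0, 2], by decide, by decide⟩ : GL (Fin 2) (ZMod 5)),
        (⟨!![0, 1; 1, 0], !![0, 1; 1, 0], by decide, by decide⟩ : GL (Fin 2) (ZMod 5))} : Set (GL (Fin 2) (ZMod 5))) ∧
        Matrix.det ((g : GL (Fin 2) (ZMod 5)) : Matrix (Fin 2) (Fin 2) (ZMod 5)) = 1}) :=
    fun u hu hd => Submodule.subset_span ⟨u, ⟨(mem_normaliserSplit_iff u).2 ⟨hu, Or.inl hd⟩, hd⟩, rfl⟩
  have m1 := mem 1 (Or.inl ⟨by simp, by simp⟩) (by simp)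
  have m2 := mem ⟨!![2, 0; 0, 3], !![3, 0; 0, 2], by decide, by decide⟩ (Or.inl ⟨rfl, rfl⟩) (by rw [Matrix.det_fin_two_of]; decide)
  have m3 := mem ⟨!![0, 1; 4, 0], !![0, 4; 1, 0], by decide, by decide⟩ (Or.inr ⟨rfl, rfl⟩) (by rw [Matrix.det_fin_two_of]; decide)
  have m4 := mem ⟨!![0, 2; 2, 0], !![0, 3; 3, 0], by decide, by decide⟩ (Or.inr ⟨rfl, rfl⟩) (by rw [Matrix.det_fin_two_of]; decide)
  rw [Units.val_one] at m1
  change (!![2, 0; 0, 3] : Matrix (Fin 2) (Fin 2) (ZMod 5)) ∈ _ at m2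
  change (!![0, 1; 4, 0] : Matrix (Fin 2) (Fin 2) (ZMod 5)) ∈ _ at m3
  change (!![0, 2; 2, 0] : Matrix (Fin 2) (Fin 2) (ZMod 5)) ∈ _ at m4
  set W := Submodule.span (ZMod 5) ((fun g : GL (Fin 2) (ZMod 5) => ((g : GL (Fin 2) (ZMod 5)) : Matrix (Fin 2) (Fin 2) (ZMod 5))) ''
      {g : GL (Fin 2) (ZMod 5) | g ∈ Subgroup.closure ({(⟨!![2, 0; 0, 2], !![3, 0; 0, 3], by decide, by decide⟩ : GL (Fin 2) (ZMod 5)),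
        (⟨!![2, 0; 0, 3], !![3, 0; 0, 2], by decide, by decide⟩ : GL (Fin 2) (ZMod 5)),
        (⟨!![0, 1; 1, 0], !![0, 1; 1, 0], by decide, by decide⟩ : GL (Fin 2) (ZMod 5))} : Set (GL (Fin 2) (ZMod 5))) ∧
        Matrix.det ((g : GL (Fin 2) (ZMod 5)) : Matrix (Fin 2) (Fin 2) (ZMod 5)) = 1})
  refine eq_top_of_elementary_mem W ?_ ?_ ?_ ?_
  · have e : (!![1, 0; 0, 0] : Matrix (Fin 2) (Fin 2) (ZMod 5)) =
        (3 : ZMod 5) • (1 : Matrix (Fin 2) (Fin 2) (ZMod 5)) + (4 : ZMod 5) • !![2, 0; 0, 3] := by decide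
    rw [e]; exact W.add_mem (W.smul_mem _ m1) (W.smul_mem _ m2)
  · have e : (!![0, 1; 0, 0] : Matrix (Fin 2) (Fin 2) (ZMod 5)) =
        (3 : ZMod 5) • (!![0, 1; 4, 0] : Matrix (Fin 2) (Fin 2) (ZMod 5)) + (4 : ZMod 5) • !![0, 2; 2, 0] := by decide
    rw [e]; exact W.add_mem (W.smul_mem _ m3) (W.smul_mem _ m4)
  · have e : (!![0, 0; 1, 0] : Matrix (Fin 2) (Fin 2) (ZMod 5)) =
        (2 : ZMod 5) • (!![0, 1; 4, 0] : Matrix (Fin 2) (Fin 2) (ZMod 5)) + (4 : ZMod 5) • !![0, 2; 2, 0] := by decide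
    rw [e]; exact W.add_mem (W.smul_mem _ m3) (W.smul_mem _ m4)
  · have e : (!![0, 0; 0, 1] : Matrix (Fin 2) (Fin 2) (ZMod 5)) =
        (3 : ZMod 5) • (1 : Matrix (Fin 2) (Fin 2) (ZMod 5)) + (1 : ZMod 5) • !![2, 0; 0, 3] := by decide
    rw [e]; exact W.add_mem (W.smul_mem _ m1) (W.smul_mem _ m2)

/-- **The determinant-one part of `N_ns^±` spans `M₂(𝔽₅)`** (it contains `1`, `a`, `diag(3,2)` and
`a·diag(3,2)`; note `diag(3,2) a diag(3,2)⁻¹ = a⁻¹`): the non-split Cartan normaliser violates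
hypothesis (d) of the census `GroupCensusFive` — route rationale (i). [folklore] -/
theorem span_detOne_normaliserNonsplit_eq_top :
    Submodule.span (ZMod 5) ((fun g : GL (Fin 2) (ZMod 5) => ((g : GL (Fin 2) (ZMod 5)) : Matrix (Fin 2) (Fin 2) (ZMod 5))) ''
      {g : GL (Fin 2) (ZMod 5) | g ∈ Subgroup.closure ({(⟨!![2, 0; 0, 2], !![3, 0; 0, 3], by decide, by decide⟩ : GL (Fin 2) (ZMod 5)),
        (⟨!![3, 1; 3, 3], !![3, 4; 2, 3], by decide, by decide⟩ : GL (Fin 2) (ZMod 5)),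
        (⟨!![1, 0; 0, 4], !![1, 0; 0, 4], by decide, by decide⟩ : GL (Fin 2) (ZMod 5))} : Set (GL (Fin 2) (ZMod 5))) ∧
        Matrix.det ((g : GL (Fin 2) (ZMod 5)) : Matrix (Fin 2) (Fin 2) (ZMod 5)) = 1}) = ⊤ := by
  have mem : ∀ u : GL (Fin 2) (ZMod 5),
      ((u : Matrix (Fin 2) (Fin 2) (ZMod 5)) * !![3, 1; 3, 3] = !![3, 1; 3, 3] * (u : Matrix (Fin 2) (Fin 2) (ZMod 5)) ∨
        (u : Matrix (Fin 2) (Fin 2) (ZMod 5)) * !![3, 1; 3, 3] = !![3, 4; 2, 3] * (u : Matrix (Fin 2) (Fin 2) (ZMod 5))) →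
      Matrix.det (u : Matrix (Fin 2) (Fin 2) (ZMod 5)) = 1 →
      (u : Matrix (Fin 2) (Fin 2) (ZMod 5)) ∈ Submodule.span (ZMod 5) ((fun g : GL (Fin 2) (ZMod 5) => ((g : GL (Fin 2) (ZMod 5)) : Matrix (Fin 2) (Fin 2) (ZMod 5))) ''
      {g : GL (Fin 2) (ZMod 5) | g ∈ Subgroup.closure ({(⟨!![2, 0; 0, 2], !![3, 0; 0, 3], by decide, by decide⟩ : GL (Fin 2) (ZMod 5)),
        (⟨!![3, 1; 3, 3], !![3, 4; 2, 3], by decide, by decide⟩ : GL (Fin 2) (ZMod 5)),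
        (⟨!![1, 0; 0, 4], !![1, 0; 0, 4], by decide, by decide⟩ : GL (Fin 2) (ZMod 5))} : Set (GL (Fin 2) (ZMod 5))) ∧
        Matrix.det ((g : GL (Fin 2) (ZMod 5)) : Matrix (Fin 2) (Fin 2) (ZMod 5)) = 1}) :=
    fun u hu hd => Submodule.subset_span ⟨u, ⟨(mem_normaliserNonsplit_iff u).2 ⟨hu, Or.inl hd⟩, hd⟩, rfl⟩
  have m1 := mem 1 (Or.inl (by rw [Units.val_one, Matrix.one_mul, Matrix.mul_one])) (by simp)
  have m2 := mem ⟨!![3, 1; 3, 3], !![3, 4; 2, 3], by decide, by decide⟩ (Or.inl (by decide)) (by rw [Matrix.det_fin_two_of]; decide)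
  have m3 := mem ⟨!![3, 0; 0, 2], !![2, 0; 0, 3], by decide, by decide⟩ (Or.inr (by decide)) (by rw [Matrix.det_fin_two_of]; decide)
  have m4 := mem ⟨!![4, 2; 4, 1], !![1, 3; 1, 4], by decide, by decide⟩ (Or.inr (by decide)) (by rw [Matrix.det_fin_two_of]; decide)
  rw [Units.val_one] at m1
  change (!![3, 1; 3, 3] : Matrix (Fin 2) (Fin 2) (ZMod 5)) ∈ _ at m2
  change (!![3, 0; 0, 2] : Matrix (Fin 2) (Fin 2) (ZMod 5)) ∈ _ at m3
  change (!![4, 2; 4, 1] : Matrix (Fin 2) (Fin 2) (ZMod 5)) ∈ _ at m4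
  set W := Submodule.span (ZMod 5) ((fun g : GL (Fin 2) (ZMod 5) => ((g : GL (Fin 2) (ZMod 5)) : Matrix (Fin 2) (Fin 2) (ZMod 5))) ''
      {g : GL (Fin 2) (ZMod 5) | g ∈ Subgroup.closure ({(⟨!![2, 0; 0, 2], !![3, 0; 0, 3], by decide, by decide⟩ : GL (Fin 2) (ZMod 5)),
        (⟨!![3, 1; 3, 3], !![3, 4; 2, 3], by decide, by decide⟩ : GL (Fin 2) (ZMod 5)),
        (⟨!![1, 0; 0, 4], !![1, 0; 0, 4], by decide, by decide⟩ : GL (Fin 2) (ZMod 5))} : Set (GL (Fin 2) (ZMod 5))) ∧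
        Matrix.det ((g : GL (Fin 2) (ZMod 5)) : Matrix (Fin 2) (Fin 2) (ZMod 5)) = 1})
  refine eq_top_of_elementary_mem W ?_ ?_ ?_ ?_
  · have e : (!![1, 0; 0, 0] : Matrix (Fin 2) (Fin 2) (ZMod 5)) =
        (3 : ZMod 5) • (1 : Matrix (Fin 2) (Fin 2) (ZMod 5)) + (1 : ZMod 5) • !![3, 0; 0, 2] := by decide
    rw [e]; exact W.add_mem (W.smul_mem _ m1) (W.smul_mem _ m3)
  · have e : (!![0, 1; 0, 0] : Matrix (Fin 2) (Fin 2) (ZMod 5)) =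
        (1 : ZMod 5) • (1 : Matrix (Fin 2) (Fin 2) (ZMod 5)) + (3 : ZMod 5) • !![3, 1; 3, 3] +
          (3 : ZMod 5) • !![3, 0; 0, 2] + (4 : ZMod 5) • !![4, 2; 4, 1] := by decide
    rw [e]
    exact W.add_mem (W.add_mem (W.add_mem (W.smul_mem _ m1) (W.smul_mem _ m2)) (W.smul_mem _ m3))
      (W.smul_mem _ m4)
  · have e : (!![0, 0; 1, 0] : Matrix (Fin 2) (Fin 2) (ZMod 5)) =
        (2 : ZMod 5) • (1 : Matrix (Fin 2) (Fin 2) (ZMod 5)) + (1 : ZMod 5) • !![3, 1; 3, 3] +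
          (4 : ZMod 5) • !![3, 0; 0, 2] + (2 : ZMod 5) • !![4, 2; 4, 1] := by decide
    rw [e]
    exact W.add_mem (W.add_mem (W.add_mem (W.smul_mem _ m1) (W.smul_mem _ m2)) (W.smul_mem _ m3))
      (W.smul_mem _ m4)
  · have e : (!![0, 0; 0, 1] : Matrix (Fin 2) (Fin 2) (ZMod 5)) =
        (3 : ZMod 5) • (1 : Matrix (Fin 2) (Fin 2) (ZMod 5)) + (4 : ZMod 5) • !![3, 0; 0, 2] := by decide
    rw [e]; exact W.add_mem (W.smul_mem _ m1) (W.smul_mem _ m3)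

end Summit.Langlands.Langlands.Theorems.GroupCensusFive
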